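import Mathlib
import Summits.NavierStokesRegularity.NavierStokesRegularity.Theorems.ThreadingFluxHorizonTowerZonalBridge
import HarnessLib

/-!
# Crux `PoloidalLiouville` (stmt-NavierStokesRegularity-1222, W1/W2), crux idea «horizon-threading-tower» (ns-idea-15):
# MIXED-DEGREE BRACKET RIGIDITY, core A — formal calculus, the composite polynomials, the Cramer decomposition and its curl

Support file (Theorems-side tooling; seat ns-wall-eng-3 g3, cell ns-wall-extremal, W1 adjunct; `--supports
stmt-NavierStokesRegularity-1222`, helper).  Part of the kernel proof of ★ MIXED-DEGREE BRACKET RIGIDITY: two non-zero real solid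
harmonics `A`, `B` on `ℝ³` of DIFFERENT degrees `l ≠ m` whose loop bracket `det(x, ∇A, ∇B)` vanishes identically are zonal about a
common axis — equivalently (ns-idea-15 «horizon-threading-tower», `OrderOneSphereEuler`): a TWO-SHELL scale-free profile
`U = U_{H_l} + U_{H_m}` passes the ORDER-ONE horizon law only if it is axisymmetric without swirl (the two-shell case of the conjecture
`HorizonTower.HorizonTowerZonality` at order one).  METHOD (pure polynomial algebra in `ℝ[x₀,x₁,x₂]`, formal partial derivatives):
Cramer decomposition `|x×∇A|²·∇B = P₁ x + P₂ ∇A`; its curl (⇒ `P₁/|x×∇A|²`, `P₂/|x×∇A|²` are first integrals of `L = (x × ∇A)·∇`)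
and divergence; the gradient of `β = P₂/|x×∇A|²` decomposed once more (`|x×∇A|²·∇β ∝ c₁ x + M ∇A`) and its curl; then
`L` applied to the divergence identity gives `N · ρ · det(∇A, ∇|∇A|², x) = 0` in the domain `ℝ[x]` with `N = (m+1)ρP₁ + l(m−l)AP₂`;
the branch `N = 0` forces `A∇B − B∇A` radial and dies on `(m−l)(l+m+1)AB = 0`; so `A` is det-zonal, hence zonal by ns-wall-eng-5 g4's
`Zonal.detZonal_allDegrees` machinery, and `B` follows by `Zonal.zonal_partner_of_bracket` (p688869).
HONEST LABEL: algebra toward one crux idea's typed conjecture; `HorizonTowerZonality` (general profiles), `PoloidalLiouville` (1222),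
`UnthreadedRigidity` (27585), 23843 and NS regularity remain OPEN; W1/W2 movement 0.  [folklore]
-/

-- the summit and its single problem share the name (D-0017 nested layout)
set_option linter.dupNamespace false

noncomputable section

open MvPolynomial Finsupp

namespace Summit.NavierStokesRegularity.NavierStokesRegularity.Theorems.PoloidalLiouville.HorizonTower.Zonal

/-! ### Formal calculus over `ℝ[x₀,x₁,x₂]` -/

section Formal

/-- Real polynomials in three variables. -/
abbrev RPoly : Type := MvPolynomial (Fin 3) ℝ

/-- Partial derivatives commute (real coefficients). [folklore] -/
theorem pderiv_comm_real (i j : Fin 3) (P : RPoly) : pderiv i (pderiv j P) = pderiv j (pderiv i P) := by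
  classical
  ext m
  simp only [coeff_pderiv]
  by_cases hij : i = j
  · subst hij; rfl
  · have h1 : (m + Finsupp.single i 1 : Fin 3 →₀ ℕ) j = m j := by
      rw [Finsupp.add_apply, Finsupp.single_apply, if_neg hij, add_zero]
    have h2 : (m + Finsupp.single j 1 : Fin 3 →₀ ℕ) i = m i := by
      rw [Finsupp.add_apply, Finsupp.single_apply, if_neg (Ne.symm hij), add_zero]
    rw [h1, h2, add_right_comm]
    ring

/-- Euler's identity, three variables, written out. [folklore] -/
theorem euler3 {P : RPoly} {n : ℕ} (h : P.IsHomogeneous n) :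
    X 0 * pderiv 0 P + X 1 * pderiv 1 P + X 2 * pderiv 2 P = C (n : ℝ) * P := by
  have := h.sum_X_mul_pderiv
  rw [Fin.sum_univ_three] at this
  rw [this, nsmul_eq_mul, map_natCast]

/-- `detP A ·` in «`w·∇`» form: `detP A Q = Σ wᵢ ∂ᵢ Q` with `w = x × ∇A`. [folklore] -/
theorem detP_eq_w (A Q : RPoly) :
    detP A Q = (X 1 * pderiv 2 A - X 2 * pderiv 1 A) * pderiv 0 Q + (X 2 * pderiv 0 A - X 0 * pderiv 2 A) * pderiv 1 Q
      + (X 0 * pderiv 1 A - X 1 * pderiv 0 A) * pderiv 2 Q := by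
  unfold detP; ring

/-- `detP A ·` is a derivation: Leibniz. [folklore] -/
theorem detP_mul_right (A P Q : RPoly) : detP A (P * Q) = P * detP A Q + Q * detP A P := by
  rw [detP_eq_w, detP_eq_w, detP_eq_w]
  simp only [Derivation.leibniz, smul_eq_mul]
  ring

/-- `detP A ·` is additive. [folklore] -/
theorem detP_add_right (A P Q : RPoly) : detP A (P + Q) = detP A P + detP A Q := by
  rw [detP_eq_w, detP_eq_w, detP_eq_w]; simp only [map_add]; ring

/-- `detP A ·` respects subtraction. [folklore] -/
theorem detP_sub_right (A P Q : RPoly) : detP A (P - Q) = detP A P - detP A Q := by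
  rw [detP_eq_w, detP_eq_w, detP_eq_w]; simp only [map_sub]; ring

/-- `detP A ·` kills scalars. [folklore] -/
theorem detP_C_mul_right (A P : RPoly) (c : ℝ) : detP A (C c * P) = C c * detP A P := by
  rw [detP_eq_w, detP_eq_w]; simp only [pderiv_C_mul]; ring

/-- `detP A A = 0`. [folklore] -/
theorem detP_self (A : RPoly) : detP A A = 0 := by unfold detP; ring

/-- `detP A ρ = 0` for `ρ = x₀² + x₁² + x₂²` (radial functions are Casimirs). [folklore] -/
theorem detP_rho (A : RPoly) : detP A (X 0 ^ 2 + X 1 ^ 2 + X 2 ^ 2) = 0 := by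
  rw [detP_eq_w]
  simp only [map_add, Derivation.leibniz_pow, pderiv_X_self, smul_eq_mul]
  simp
  ring

/-- `detP A ·` respects negation. [folklore] -/
theorem detP_neg_right (A P : RPoly) : detP A (-P) = -detP A P := by
  rw [detP_eq_w, detP_eq_w]; simp only [map_neg]; ring

/-- `ρ = x₀² + x₁² + x₂²` is not the zero polynomial. [folklore] -/
theorem rho_ne_zero : (X 0 ^ 2 + X 1 ^ 2 + X 2 ^ 2 : RPoly) ≠ 0 := by
  intro h
  have := congrArg (fun p : RPoly => evalE p (EuclideanSpace.single 0 1)) h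
  simp [evalE] at this

/-- **Non-radiality**: for a non-zero harmonic `A` of degree `l ≥ 1`, `|x × ∇A|² = ρ|∇A|² − l²A²` is not the zero polynomial. -/
theorem wq_ne_zero {A : RPoly} {l : ℕ} (hA : A.IsHomogeneous l) (hl : 1 ≤ l) (hlA : lapP A = 0) (hA0 : A ≠ 0) :
    (X 0 ^ 2 + X 1 ^ 2 + X 2 ^ 2) * (pderiv 0 A * pderiv 0 A + pderiv 1 A * pderiv 1 A + pderiv 2 A * pderiv 2 A)
      - C (l : ℝ) * C (l : ℝ) * A * A ≠ 0 := by
  intro hW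
  set a0 := pderiv 0 A with ha0
  set a1 := pderiv 1 A with ha1
  set a2 := pderiv 2 A with ha2
  have eA : X 0 * a0 + X 1 * a1 + X 2 * a2 = C (l : ℝ) * A := by rw [ha0, ha1, ha2, euler3 hA]
  -- Lagrange: `Σ wᵢ² = Wq = 0`
  have hsq : (X 1 * a2 - X 2 * a1) * (X 1 * a2 - X 2 * a1) + (X 2 * a0 - X 0 * a2) * (X 2 * a0 - X 0 * a2)
      + (X 0 * a1 - X 1 * a0) * (X 0 * a1 - X 1 * a0) = 0 := by
    linear_combination hW - (X 0 * a0 + X 1 * a1 + X 2 * a2 + C (l : ℝ) * A) * eA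
  -- each `wᵢ` vanishes (sum of real squares)
  have hw : ∀ y : E3, evalE (X 1 * a2 - X 2 * a1) y = 0 ∧ evalE (X 2 * a0 - X 0 * a2) y = 0 ∧ evalE (X 0 * a1 - X 1 * a0) y = 0 := by
    intro y
    have h := congrArg (fun p => evalE p y) hsq
    simp only [evalE_add, evalE_mul, evalE_zero] at h
    have h1 := mul_self_nonneg (evalE (X 1 * a2 - X 2 * a1) y)
    have h2 := mul_self_nonneg (evalE (X 2 * a0 - X 0 * a2) y)
    have h3 := mul_self_nonneg (evalE (X 0 * a1 - X 1 * a0) y)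
    refine ⟨mul_self_eq_zero.mp (by linarith), mul_self_eq_zero.mp (by linarith), mul_self_eq_zero.mp (by linarith)⟩
  have w0 : X 1 * a2 - X 2 * a1 = 0 := eq_zero_of_evalE_eq_zero fun y => (hw y).1
  have w1 : X 2 * a0 - X 0 * a2 = 0 := eq_zero_of_evalE_eq_zero fun y => (hw y).2.1
  have w2 : X 0 * a1 - X 1 * a0 = 0 := eq_zero_of_evalE_eq_zero fun y => (hw y).2.2
  -- radial gradient: `ρ aᵢ = l A xᵢ`
  have r0 : (X 0 ^ 2 + X 1 ^ 2 + X 2 ^ 2) * a0 = C (l : ℝ) * A * X 0 := by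
    linear_combination (-X 1) * w2 + X 2 * w1 + X 0 * eA
  have r1 : (X 0 ^ 2 + X 1 ^ 2 + X 2 ^ 2) * a1 = C (l : ℝ) * A * X 1 := by
    linear_combination X 0 * w2 - X 2 * w0 + X 1 * eA
  have r2 : (X 0 ^ 2 + X 1 ^ 2 + X 2 ^ 2) * a2 = C (l : ℝ) * A * X 2 := by
    linear_combination (-X 0) * w1 + X 1 * w0 + X 2 * eA
  -- divergence: `2lA = 3lA + l²A`
  have lapA : pderiv 0 a0 + pderiv 1 a1 + pderiv 2 a2 = 0 := by rw [ha0, ha1, ha2]; exact hlA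
  have d0 := congrArg (pderiv 0) r0
  have d1 := congrArg (pderiv 1) r1
  have d2 := congrArg (pderiv 2) r2
  simp only [Derivation.leibniz, Derivation.leibniz_pow, smul_eq_mul, map_add, pderiv_X_self, pderiv_C,
    pderiv_X_of_ne (show (0:Fin 3) ≠ 1 by decide), pderiv_X_of_ne (show (0:Fin 3) ≠ 2 by decide),
    pderiv_X_of_ne (show (1:Fin 3) ≠ 0 by decide), pderiv_X_of_ne (show (1:Fin 3) ≠ 2 by decide),
    pderiv_X_of_ne (show (2:Fin 3) ≠ 0 by decide), pderiv_X_of_ne (show (2:Fin 3) ≠ 1 by decide)] at d0 d1 d2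
  rw [← ha0] at d0
  rw [← ha1] at d1
  rw [← ha2] at d2
  have key : C ((l : ℝ) * ((l : ℝ) + 1)) * A = 0 := by
    rw [map_mul, map_add, map_one]
    linear_combination (-1 : RPoly) * d0 - d1 - d2 + (X 0 ^ 2 + X 1 ^ 2 + X 2 ^ 2) * lapA + (2 - C (l : ℝ)) * eA
  have hc : (C ((l : ℝ) * ((l : ℝ) + 1)) : RPoly) ≠ 0 := by
    have : (0 : ℝ) < l := by exact_mod_cast hl
    exact C_eq_zero.not.mpr (by positivity)
  exact hA0 ((mul_eq_zero.mp key).resolve_left hc)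

end Formal

/-! ### The composite polynomials of the mixed-degree argument -/

section Defs

variable (l m : ℕ) (A B : RPoly)

/-- `ρ = x₀² + x₁² + x₂²`. -/
def rhoP : RPoly := X 0 ^ 2 + X 1 ^ 2 + X 2 ^ 2
/-- `G = |∇A|²`. -/
def gP : RPoly := pderiv 0 A * pderiv 0 A + pderiv 1 A * pderiv 1 A + pderiv 2 A * pderiv 2 A
/-- `H = ∇A·∇B`. -/
def hP : RPoly := pderiv 0 A * pderiv 0 B + pderiv 1 A * pderiv 1 B + pderiv 2 A * pderiv 2 B
/-- `Wq = ρG − l²A² = |x × ∇A|²` (for `A` homogeneous of degree `l`). -/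
def wq : RPoly := rhoP * gP A - C (l : ℝ) * C (l : ℝ) * A * A
/-- `P₁ = mBG − lAH` (the radial Cramer coefficient of `∇B`). -/
def pone : RPoly := C (m : ℝ) * B * gP A - C (l : ℝ) * A * hP A B
/-- `P₂ = ρH − lmAB` (the `∇A` Cramer coefficient of `∇B`). -/
def ptwo : RPoly := rhoP * hP A B - C (l : ℝ) * C (m : ℝ) * A * B
/-- `pᵢ = Wq ∂ᵢP₂ − P₂ ∂ᵢWq` (`= Wq² ∂ᵢ(P₂/Wq)`). -/
def pv (i : Fin 3) : RPoly := wq l A * pderiv i (ptwo l m A B) - ptwo l m A B * pderiv i (wq l A)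
/-- `p·x`. -/
def pxs : RPoly := X 0 * pv l m A B 0 + X 1 * pv l m A B 1 + X 2 * pv l m A B 2
/-- `p·∇A`. -/
def pas : RPoly := pderiv 0 A * pv l m A B 0 + pderiv 1 A * pv l m A B 1 + pderiv 2 A * pv l m A B 2
/-- `c₁ = (p·x)G − (p·∇A) lA`. -/
def cone : RPoly := pxs l m A B * gP A - pas l m A B * (C (l : ℝ) * A)
/-- `M = (p·∇A)ρ − (p·x) lA` (`= −Wq² β₂`). -/
def mm : RPoly := pas l m A B * rhoP - pxs l m A B * (C (l : ℝ) * A)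
/-- `N = (m+1)ρP₁ + l(m−l)AP₂` (`M = −Wq N`). -/
def nn : RPoly := (C (m : ℝ) + 1) * rhoP * pone l m A B + C (l : ℝ) * (C (m : ℝ) - C (l : ℝ)) * A * ptwo l m A B

end Defs

section Stages

variable {l m : ℕ} {A B : RPoly}

/-- Stage E: the Cramer decomposition `Wq ∂ᵢB = P₁ xᵢ + P₂ ∂ᵢA` (from `det(x,∇A,∇B) = 0` and Euler). -/
theorem stageE (hA : A.IsHomogeneous l) (hB : B.IsHomogeneous m) (hlA : lapP A = 0) (hlB : lapP B = 0)
    (hD : detP A B = 0) :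
    wq l A * pderiv 0 B = pone l m A B * X 0 + ptwo l m A B * pderiv 0 A ∧
    wq l A * pderiv 1 B = pone l m A B * X 1 + ptwo l m A B * pderiv 1 A ∧
    wq l A * pderiv 2 B = pone l m A B * X 2 + ptwo l m A B * pderiv 2 A := by
  set a0 := pderiv 0 A with ha0
  set a1 := pderiv 1 A with ha1
  set a2 := pderiv 2 A with ha2
  set b0 := pderiv 0 B with hb0
  set b1 := pderiv 1 B with hb1
  set b2 := pderiv 2 B with hb2
  set ρ : RPoly := rhoP with hρ'
  set G : RPoly := gP A with hG'
  set H : RPoly := hP A B with hH'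
  set Wq : RPoly := wq l A with hWq'
  set P₁ : RPoly := pone l m A B with hP₁'
  set P₂ : RPoly := ptwo l m A B with hP₂'
  have hρ : ρ = X 0 ^ 2 + X 1 ^ 2 + X 2 ^ 2 := by rw [hρ']; rfl
  have hG : G = a0 * a0 + a1 * a1 + a2 * a2 := by rw [hG', ha0, ha1, ha2]; rfl
  have hH : H = a0 * b0 + a1 * b1 + a2 * b2 := by rw [hH', ha0, ha1, ha2, hb0, hb1, hb2]; rfl
  have hWq : Wq = ρ * G - C (l : ℝ) * C (l : ℝ) * A * A := by rw [hWq', hρ', hG']; rfl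
  have hP₁ : P₁ = C (m : ℝ) * B * G - C (l : ℝ) * A * H := by rw [hP₁', hG', hH']; rfl
  have hP₂ : P₂ = ρ * H - C (l : ℝ) * C (m : ℝ) * A * B := by rw [hP₂', hρ', hH']; rfl
  have sa01 : pderiv 1 a0 = pderiv 0 a1 := by rw [ha0, ha1, pderiv_comm_real]
  have sa02 : pderiv 2 a0 = pderiv 0 a2 := by rw [ha0, ha2, pderiv_comm_real]
  have sa12 : pderiv 2 a1 = pderiv 1 a2 := by rw [ha1, ha2, pderiv_comm_real]
  have sb01 : pderiv 1 b0 = pderiv 0 b1 := by rw [hb0, hb1, pderiv_comm_real]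
  have sb02 : pderiv 2 b0 = pderiv 0 b2 := by rw [hb0, hb2, pderiv_comm_real]
  have sb12 : pderiv 2 b1 = pderiv 1 b2 := by rw [hb1, hb2, pderiv_comm_real]
  have lapA : pderiv 0 a0 + pderiv 1 a1 + pderiv 2 a2 = 0 := by rw [ha0, ha1, ha2]; exact hlA
  have lapB : pderiv 0 b0 + pderiv 1 b1 + pderiv 2 b2 = 0 := by rw [hb0, hb1, hb2]; exact hlB
  have eA : X 0 * a0 + X 1 * a1 + X 2 * a2 = C (l : ℝ) * A := by rw [ha0, ha1, ha2, euler3 hA]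
  have eB : X 0 * b0 + X 1 * b1 + X 2 * b2 = C (m : ℝ) * B := by rw [hb0, hb1, hb2, euler3 hB]
  have hD' : (X 1 * a2 - X 2 * a1) * b0 + (X 2 * a0 - X 0 * a2) * b1 + (X 0 * a1 - X 1 * a0) * b2 = 0 := by
    rw [ha0, ha1, ha2, hb0, hb1, hb2, ← detP_eq_w, hD]
  have LdP : ∀ Q : RPoly, detP A Q = (X 1 * a2 - X 2 * a1) * pderiv 0 Q + (X 2 * a0 - X 0 * a2) * pderiv 1 Q
      + (X 0 * a1 - X 1 * a0) * pderiv 2 Q := fun Q => by rw [detP_eq_w]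
  -- I1 (Cramer): `Wq bᵢ = P₁ xᵢ + P₂ aᵢ`
  have E0 : Wq * b0 = P₁ * X 0 + P₂ * a0 := by
    have cr : (ρ * G - (X 0 * a0 + X 1 * a1 + X 2 * a2) * (X 0 * a0 + X 1 * a1 + X 2 * a2)) * b0
        = ((X 0 * b0 + X 1 * b1 + X 2 * b2) * G - (X 0 * a0 + X 1 * a1 + X 2 * a2) * H) * X 0
          + (ρ * H - (X 0 * a0 + X 1 * a1 + X 2 * a2) * (X 0 * b0 + X 1 * b1 + X 2 * b2)) * a0
          + ((X 1 * a2 - X 2 * a1) * b0 + (X 2 * a0 - X 0 * a2) * b1 + (X 0 * a1 - X 1 * a0) * b2)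
            * (X 1 * a2 - X 2 * a1) := by
      rw [hρ, hG, hH]; ring
    rw [eA, eB, hD', zero_mul, add_zero] at cr
    rw [hWq, hP₁, hP₂]
    linear_combination cr
  have E1 : Wq * b1 = P₁ * X 1 + P₂ * a1 := by
    have cr : (ρ * G - (X 0 * a0 + X 1 * a1 + X 2 * a2) * (X 0 * a0 + X 1 * a1 + X 2 * a2)) * b1
        = ((X 0 * b0 + X 1 * b1 + X 2 * b2) * G - (X 0 * a0 + X 1 * a1 + X 2 * a2) * H) * X 1
          + (ρ * H - (X 0 * a0 + X 1 * a1 + X 2 * a2) * (X 0 * b0 + X 1 * b1 + X 2 * b2)) * a1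
          + ((X 1 * a2 - X 2 * a1) * b0 + (X 2 * a0 - X 0 * a2) * b1 + (X 0 * a1 - X 1 * a0) * b2)
            * (X 2 * a0 - X 0 * a2) := by
      rw [hρ, hG, hH]; ring
    rw [eA, eB, hD', zero_mul, add_zero] at cr
    rw [hWq, hP₁, hP₂]
    linear_combination cr
  have E2 : Wq * b2 = P₁ * X 2 + P₂ * a2 := by
    have cr : (ρ * G - (X 0 * a0 + X 1 * a1 + X 2 * a2) * (X 0 * a0 + X 1 * a1 + X 2 * a2)) * b2
        = ((X 0 * b0 + X 1 * b1 + X 2 * b2) * G - (X 0 * a0 + X 1 * a1 + X 2 * a2) * H) * X 2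
          + (ρ * H - (X 0 * a0 + X 1 * a1 + X 2 * a2) * (X 0 * b0 + X 1 * b1 + X 2 * b2)) * a2
          + ((X 1 * a2 - X 2 * a1) * b0 + (X 2 * a0 - X 0 * a2) * b1 + (X 0 * a1 - X 1 * a0) * b2)
            * (X 0 * a1 - X 1 * a0) := by
      rw [hρ, hG, hH]; ring
    rw [eA, eB, hD', zero_mul, add_zero] at cr
    rw [hWq, hP₁, hP₂]
    linear_combination cr
  exact ⟨E0, E1, E2⟩

/-- Stage F: flatness of `P₁`, `P₂` along `L = detP A ·` (curl of stage E). -/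
theorem stageF (hA : A.IsHomogeneous l) (hB : B.IsHomogeneous m) (hlA : lapP A = 0) (hlB : lapP B = 0)
    (hD : detP A B = 0) :
    wq l A * detP A (pone l m A B) = pone l m A B * detP A (wq l A) ∧
    wq l A * detP A (ptwo l m A B) = ptwo l m A B * detP A (wq l A) := by
  set a0 := pderiv 0 A with ha0
  set a1 := pderiv 1 A with ha1
  set a2 := pderiv 2 A with ha2
  set b0 := pderiv 0 B with hb0
  set b1 := pderiv 1 B with hb1
  set b2 := pderiv 2 B with hb2
  set ρ : RPoly := rhoP with hρ'
  set G : RPoly := gP A with hG'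
  set H : RPoly := hP A B with hH'
  set Wq : RPoly := wq l A with hWq'
  set P₁ : RPoly := pone l m A B with hP₁'
  set P₂ : RPoly := ptwo l m A B with hP₂'
  have hρ : ρ = X 0 ^ 2 + X 1 ^ 2 + X 2 ^ 2 := by rw [hρ']; rfl
  have hG : G = a0 * a0 + a1 * a1 + a2 * a2 := by rw [hG', ha0, ha1, ha2]; rfl
  have hH : H = a0 * b0 + a1 * b1 + a2 * b2 := by rw [hH', ha0, ha1, ha2, hb0, hb1, hb2]; rfl
  have hWq : Wq = ρ * G - C (l : ℝ) * C (l : ℝ) * A * A := by rw [hWq', hρ', hG']; rfl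
  have hP₁ : P₁ = C (m : ℝ) * B * G - C (l : ℝ) * A * H := by rw [hP₁', hG', hH']; rfl
  have hP₂ : P₂ = ρ * H - C (l : ℝ) * C (m : ℝ) * A * B := by rw [hP₂', hρ', hH']; rfl
  have sa01 : pderiv 1 a0 = pderiv 0 a1 := by rw [ha0, ha1, pderiv_comm_real]
  have sa02 : pderiv 2 a0 = pderiv 0 a2 := by rw [ha0, ha2, pderiv_comm_real]
  have sa12 : pderiv 2 a1 = pderiv 1 a2 := by rw [ha1, ha2, pderiv_comm_real]
  have sb01 : pderiv 1 b0 = pderiv 0 b1 := by rw [hb0, hb1, pderiv_comm_real]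
  have sb02 : pderiv 2 b0 = pderiv 0 b2 := by rw [hb0, hb2, pderiv_comm_real]
  have sb12 : pderiv 2 b1 = pderiv 1 b2 := by rw [hb1, hb2, pderiv_comm_real]
  have lapA : pderiv 0 a0 + pderiv 1 a1 + pderiv 2 a2 = 0 := by rw [ha0, ha1, ha2]; exact hlA
  have lapB : pderiv 0 b0 + pderiv 1 b1 + pderiv 2 b2 = 0 := by rw [hb0, hb1, hb2]; exact hlB
  have eA : X 0 * a0 + X 1 * a1 + X 2 * a2 = C (l : ℝ) * A := by rw [ha0, ha1, ha2, euler3 hA]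
  have eB : X 0 * b0 + X 1 * b1 + X 2 * b2 = C (m : ℝ) * B := by rw [hb0, hb1, hb2, euler3 hB]
  have hD' : (X 1 * a2 - X 2 * a1) * b0 + (X 2 * a0 - X 0 * a2) * b1 + (X 0 * a1 - X 1 * a0) * b2 = 0 := by
    rw [ha0, ha1, ha2, hb0, hb1, hb2, ← detP_eq_w, hD]
  have LdP : ∀ Q : RPoly, detP A Q = (X 1 * a2 - X 2 * a1) * pderiv 0 Q + (X 2 * a0 - X 0 * a2) * pderiv 1 Q
      + (X 0 * a1 - X 1 * a0) * pderiv 2 Q := fun Q => by rw [detP_eq_w]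
  obtain ⟨E0, E1, E2⟩ := stageE hA hB hlA hlB hD
  -- I2: curl of I1.  `C_k : ∂ⱼ(Wq bᵢ) − ∂ᵢ(Wq bⱼ)` expanded
  have C01 : pderiv 1 Wq * b0 - pderiv 0 Wq * b1
      = pderiv 1 P₁ * X 0 - pderiv 0 P₁ * X 1 + pderiv 1 P₂ * a0 - pderiv 0 P₂ * a1 := by
    have h := congrArg (pderiv 1) E0
    have h' := congrArg (pderiv 0) E1
    simp only [Derivation.leibniz, smul_eq_mul, map_add, pderiv_X_of_ne (show (0:Fin 3) ≠ 1 by decide),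
      pderiv_X_of_ne (show (1:Fin 3) ≠ 0 by decide)] at h h'
    rw [sb01] at h
    rw [sa01] at h
    linear_combination h - h'
  have C12 : pderiv 2 Wq * b1 - pderiv 1 Wq * b2
      = pderiv 2 P₁ * X 1 - pderiv 1 P₁ * X 2 + pderiv 2 P₂ * a1 - pderiv 1 P₂ * a2 := by
    have h := congrArg (pderiv 2) E1
    have h' := congrArg (pderiv 1) E2
    simp only [Derivation.leibniz, smul_eq_mul, map_add, pderiv_X_of_ne (show (1:Fin 3) ≠ 2 by decide),
      pderiv_X_of_ne (show (2:Fin 3) ≠ 1 by decide)] at h h'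
    rw [sb12] at h
    rw [sa12] at h
    linear_combination h - h'
  have C20 : pderiv 0 Wq * b2 - pderiv 2 Wq * b0
      = pderiv 0 P₁ * X 2 - pderiv 2 P₁ * X 0 + pderiv 0 P₂ * a2 - pderiv 2 P₂ * a0 := by
    have h := congrArg (pderiv 0) E2
    have h' := congrArg (pderiv 2) E0
    simp only [Derivation.leibniz, smul_eq_mul, map_add, pderiv_X_of_ne (show (2:Fin 3) ≠ 0 by decide),
      pderiv_X_of_ne (show (0:Fin 3) ≠ 2 by decide)] at h h'
    rw [← sb02] at h
    rw [← sa02] at h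
    linear_combination h - h'
  -- flatness: `Wq · L P₁ = P₁ · L Wq` (dot the curl identity with `a`) and `Wq · L P₂ = P₂ · L Wq` (dot with `x`)
  have F1 : Wq * detP A P₁ = P₁ * detP A Wq := by
    rw [LdP, LdP]
    linear_combination (Wq * a2) * C01 + (Wq * a0) * C12 + (Wq * a1) * C20
      + (a1 * pderiv 2 Wq - a2 * pderiv 1 Wq) * E0 + (a2 * pderiv 0 Wq - a0 * pderiv 2 Wq) * E1
      + (a0 * pderiv 1 Wq - a1 * pderiv 0 Wq) * E2
  have F2 : Wq * detP A P₂ = P₂ * detP A Wq := by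
    rw [LdP, LdP]
    linear_combination (-Wq * X 2) * C01 + (-Wq * X 0) * C12 + (-Wq * X 1) * C20
      + (X 2 * pderiv 1 Wq - X 1 * pderiv 2 Wq) * E0 + (X 0 * pderiv 2 Wq - X 2 * pderiv 0 Wq) * E1
      + (X 1 * pderiv 0 Wq - X 0 * pderiv 1 Wq) * E2
  exact ⟨F1, F2⟩

end Stages

end Summit.NavierStokesRegularity.NavierStokesRegularity.Theorems.PoloidalLiouville.HorizonTower.Zonal

end
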